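import Literature.NumberTheory.LFunctions.KMVHeckeRecursionExactAFE
import Literature.NumberTheory.ModularForms.NewformHeckeMultiplicativity
import HarnessLib

/-!
# KMV 2000, Lemma 3.1 (10) — DISCHARGED: `kmv2000_lemma31_holds`

Topic `Literature/NumberTheory/LFunctions` (cell landau-siegel / ls-inputs, row H-Hecke of INPUT LIST v1.3 §1H, K-INPUTS-7 (2);
the printed fact feeds helper H4′ of the registered line `diagonal_kernel_split` on the rank-2 crux
`PrimeLevelFamEdge.BeyondDiagonalBeatsQuarter`, stmt-Parity-20343).

The named fact `kmv2000_lemma31` (`KMVHeckeRecursionExactAFE`, typed by the ls-idea cell) is Kowalski–Michel–VanderKam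
2000, Lemma 3.1 (10) p. 8, verbatim: «For m, n ≥ 1 and f ∈ S₂(q)* one has λ_f(m)λ_f(n) = Σ_{d|(m,n)} ε_q(d) λ_f(mn/d²)
where ε_q is the trivial character modulo q» (`q` prime, weight `2`, `λ_f = GL2Family.heckeLambda f`, the sum over
`(gcd m n).divisors.filter (¬ q ∣ ·)`). It is now a THEOREM of the tree:

* `kmv2000_lemma31_holds : kmv2000_lemma31` — the prime-level, weight-`2` instance of the general Hecke
  multiplicativity `Literature.NumberTheory.ModularForms.heckeLambda_mul_heckeLambda_primeLevel` (any weight, any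
  prime level; itself the renormalisation of `cuspCoeff_mul_cuspCoeff`: `a_m a_n = Σ_{d ∣ (m,n), (d,N)=1} d^{k−1} a_{mn/d²}`
  for newforms on `Γ₀(N)`, proved from the tree's `IsNewform0.cuspCoeff_prime_mul` and
  `IsNewform0.coeff_mul_of_coprime_holds`);
* `heckeLambda_mul_heckeLambda_of_lt_level` — the unconditional form of `heckeLambda_mul_of_lt_level`: for
  `1 ≤ m < q` the sum runs over ALL `d ∣ (m, n)` (KMV p. 13: below the level «the trivial character ε_q won't appear»);
* `heckeLambda_mul_heckeLambda_of_not_dvd` — the same whenever `q ∤ gcd(m, n)` (e.g. `(mn, q) = 1`, the shape used by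
  the GATE-G2 shape ledger, row a1/H-Hecke).

Every consumer taking `(h : kmv2000_lemma31)` can now be fed `kmv2000_lemma31_holds`. Nothing here is a new definition
or a new named fact; no summit statement and no statement about Landau–Siegel zeros is proved by this file.

## References
* [KowalskiMichelVanderKam2000] Lemma 3.1 (10) p. 8; p. 13 (remark after (23)).
* [DiamondShurman2005] Prop. 5.8.5 (the prime recursions behind the proof).
-/

noncomputable section

open scoped MatrixGroups
open CongruenceSubgroup Complex Finset
open Literature.NumberTheory.EllipticCurves.ModularForms

namespace Literature.NumberTheory.LFunctions.KMV2000

/-- **KMV 2000, Lemma 3.1 (10) — PROVED.** «For m, n ≥ 1 and f ∈ S₂(q)* one has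
λ_f(m)λ_f(n) = Σ_{d|(m,n)} ε_q(d) λ_f(mn/d²) where ε_q is the trivial character modulo q»: the discharge of the named
fact `kmv2000_lemma31`, by `Literature.NumberTheory.ModularForms.heckeLambda_mul_heckeLambda_primeLevel` (Hecke
multiplicativity for newforms on `Γ₀(q)`, iterated Diamond–Shurman Prop. 5.8.5) at weight `2`; the hypotheses
`1 ≤ m`, `1 ≤ n` of the print are not needed (`λ_f(0) = 0`). [cite: KowalskiMichelVanderKam2000, Lemma 3.1 (10) p. 8] -/
theorem kmv2000_lemma31_holds : kmv2000_lemma31 := by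
  intro q _ hq f hf m n _ _
  exact Literature.NumberTheory.ModularForms.heckeLambda_mul_heckeLambda_primeLevel hq hf m n

/-- (10) below the level, UNCONDITIONAL (formerly `heckeLambda_mul_of_lt_level (h : kmv2000_lemma31)`): for a prime
level `q`, `f ∈ S₂(q)*`, `1 ≤ m < q` and `1 ≤ n`, `λ_f(m) λ_f(n) = Σ_{d ∣ (m,n)} λ_f(mn/d²)` over all divisors
(KMV p. 13: «since q, the level, is prime, and we have the restriction m₁, m₂ < M … the trivial character ε_q won't
appear»). [cite: KowalskiMichelVanderKam2000, Lemma 3.1 (10) p. 8 with p. 13] -/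
theorem heckeLambda_mul_heckeLambda_of_lt_level {q : ℕ} [NeZero q] (hq : q.Prime) {f : CuspForm (Gamma0 q) 2}
    (hf : f ∈ newforms0 q 2) {m n : ℕ} (hm : 1 ≤ m) (hmq : m < q) (hn : 1 ≤ n) :
    GL2Family.heckeLambda f m * GL2Family.heckeLambda f n =
      ∑ d ∈ (Nat.gcd m n).divisors, GL2Family.heckeLambda f (m * n / d ^ 2) :=
  heckeLambda_mul_of_lt_level kmv2000_lemma31_holds hq hf hm hmq hn

/-- (10) with `ε_q ≡ 1` whenever `q ∤ gcd(m, n)` (in particular when `(mn, q) = 1`): for a prime level `q`, a newform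
`f ∈ S_k(Γ₀(q))` of any weight and such `m, n`, `λ_f(m) λ_f(n) = Σ_{d ∣ (m,n)} λ_f(mn/d²)` over all divisors — the
shape consumed by the dispersion set-up of the `BeyondDiagonalBeatsQuarter` line (GATE-G2 shape ledger, row a1).
[cite: KowalskiMichelVanderKam2000, Lemma 3.1 (10) p. 8 with p. 13] -/
theorem heckeLambda_mul_heckeLambda_of_not_dvd {q : ℕ} [NeZero q] (hq : q.Prime) {k : ℤ} {f : CuspForm (Gamma0 q) k}
    (hf : IsNewform0 f) {m n : ℕ} (hmn : ¬ q ∣ Nat.gcd m n) :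
    GL2Family.heckeLambda f m * GL2Family.heckeLambda f n =
      ∑ d ∈ (Nat.gcd m n).divisors, GL2Family.heckeLambda f (m * n / d ^ 2) :=
  Literature.NumberTheory.ModularForms.heckeLambda_mul_heckeLambda_of_coprime hf
    (Nat.coprime_comm.mp (hq.coprime_iff_not_dvd.mpr hmn))

end Literature.NumberTheory.LFunctions.KMV2000

end
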